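import Summits.ResolutionOfSingularities.ResolutionOfSingularities.Theorems.FrobeniusClosingSteerCurveStepCleaning
import Literature.AlgebraicGeometry.Resolution.RegularLocalRingsProofs
import HarnessLib

/-!
# Crux `Steer` (stmt-ResolutionOfSingularities-16345), chain W4.1 — σ-residual LOW at `p = 2`, §σ2.24 piece **D3b′
# `LowTowerPointStepsIOTwo`**: a LOW TOWER has infinitely many point stages

OURS (campaign `res-hironaka`, rung L, slot W4.1, chain W4.1; replaces the role of no printed item; NOT a statement of the manuscript
under review [claim: Hironaka2017, status: under-review]; AI review is weaker than expert review).  Theses-free, definition-free helper for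
res-L0-w41-strat-2's §σ2.24 tower-level Prop `LowTowerPointStepsIOTwo` (`L/res-L0-w41-strat-2/LowTower-s24-strat2.r30.delta.lean`
2e9369ff43f44bad; res-L0-w41-plan-1 RULING 41: words of record, D3b′ := this seat), over the clauses of the interface `IsLowTowerTwo` it
consumes: (T1) the surface germs `A n ≤ L` are regular local and essentially of finite type over the perfect field `k`; (T2) `h n ∈ A n`;
(T3) `h n` is not the square of a fraction of `A n`; (T5) step data `g n ∈ A n`, `x n ∈ 𝔪_{A n} ∖ 0` with the radicand law
`h (n+1) · (x n)² = h n − (g n)²`; (T7) at a NON-point stage the surface germ does not change, `A (n+1) = A n`.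

> **D3b′.** `pt` (the set of point stages) is INFINITE.

Proof (`pt_infinite`): were `pt` finite, from some `n₀` on every stage is a curve stage, so `A n = A n₀ =: A` for `n ≥ n₀` (T7), and (T5) is a
curve chain `h i − (g i)² = (x i)² · h (i+1)` in the FIXED ring `A` with `x i ∈ 𝔪_A`; by the tree's `CurveStepCleaning.exists_sq_eq_of_eventual_
curveChain_subring` (res-D-pv-007 p516773: every derivation of `A` then kills `h n₀`, and derivations detect non-squares in the integrally closed
`A` essentially of finite type over the perfect `k` — `NormalStart.exists_derivation_apply_ne_zero`) `h n₀ = c²` with `c ∈ A`, contradicting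
(T3) with `v = 1`.  The ≤ 12-line in-skeleton leaf `lowTowerPointStepsIOTwo_holds` only projects the clauses of `IsLowTowerTwo`.

No named facts, no definitions, no `sorry`. [cite: Matsumura1987, §26 Thm. 26.5 (context)] [folklore]
-/

noncomputable section

-- `Summit.<S>.<S>.…` duplicates the summit name by design (single-problem summit).
set_option linter.dupNamespace false
set_option autoImplicit false

namespace Summit.ResolutionOfSingularities.ResolutionOfSingularities.Theorems.SwitchingDichotomy.LowTowerPointSteps

open IsLocalRing
open Literature.AlgebraicGeometry.Resolution (isIntegrallyClosed_of_isRegularLocalRing)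
open Summit.ResolutionOfSingularities.ResolutionOfSingularities.Theorems.SwitchingDichotomy
  (CurveStepCleaning.exists_sq_eq_of_eventual_curveChain_subring)

variable {L : Type} [Field L]

/-- Transport of maximal-ideal membership along an EQUALITY of local subrings of a field (the local-ring instances may differ as terms;
they are propositions). [folklore] -/
theorem mem_maximalIdeal_congr {S S' : Subring L} (e : S = S') (hS : IsLocalRing S) (hS' : IsLocalRing S') {y : L} (hy : y ∈ S)
    (hy' : y ∈ S') : ((⟨y, hy⟩ : S) ∈ @maximalIdeal S _ hS) ↔ ((⟨y, hy'⟩ : S') ∈ @maximalIdeal S' _ hS') := by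
  subst e
  exact Iff.rfl

/-- **Eventual constancy of the surface germ** when no point stage occurs after `n₀` ((T7): `A (n+1) = A n` off `pt`). [folklore] -/
theorem eq_of_forall_not_mem {k : Type} [Field k] [Algebra k L] (A : ℕ → Subalgebra k L) (pt : Set ℕ)
    (hT7 : ∀ n, n ∉ pt → A (n + 1) = A n) {n₀ : ℕ} (hno : ∀ n, n₀ ≤ n → n ∉ pt) :
    ∀ n, n₀ ≤ n → A n = A n₀ := by
  intro n hn
  induction n, hn using Nat.le_induction with
  | base => rfl
  | succ n hn ih => rw [hT7 n (hno n hn), ih]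

/-- **D3b′ · a LOW tower has infinitely many point stages** (helper form over the consumed clauses of `IsLowTowerTwo`; binders VERBATIM
from strat-2's interface where quoted): (T1)' regular + essentially of finite type surface germs, (T2)' `h n ∈ A n`, (T3) hygiene, (T5)'
step data and the radicand law, (T7)' `A (n+1) = A n` at non-point stages ⟹ `pt.Infinite`. [folklore] -/
theorem pt_infinite (k : Type) [Field k] [CharP k 2] [PerfectField k] [Algebra k L]
    (A : ℕ → Subalgebra k L) (h x g : ℕ → L) (pt : Set ℕ)
    (hAl : ∀ n, IsLocalRing (A n).toSubring)
    (hT1 : ∀ n, IsRegularLocalRing (A n).toSubring ∧ Algebra.EssFiniteType k (A n))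
    (hT2 : ∀ n, h n ∈ A n)
    (hT3 : ∀ n, ∀ u v : L, u ∈ A n → v ∈ A n → v ≠ 0 → (u / v) ^ 2 ≠ h n)
    (hT5 : ∀ n, g n ∈ A n ∧ x n ≠ 0 ∧
      (∃ hx : x n ∈ A n, (⟨x n, hx⟩ : (A n).toSubring) ∈ @maximalIdeal _ _ (hAl n)) ∧
      h (n + 1) * x n ^ 2 = h n - g n ^ 2)
    (hT7 : ∀ n, n ∉ pt → A (n + 1) = A n) : pt.Infinite := by
  by_contra hfin
  rw [Set.not_infinite] at hfin
  -- after the last point stage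
  obtain ⟨M, hM⟩ := hfin.bddAbove
  set n₀ := M + 1 with hn₀
  have hno : ∀ n, n₀ ≤ n → n ∉ pt := fun n hn hmem => by
    have := hM hmem
    omega
  have hA : ∀ n, n₀ ≤ n → A n = A n₀ := eq_of_forall_not_mem A pt hT7 hno
  -- the fixed surface germ `S := A n₀` and its structure
  haveI hloc : IsLocalRing (A n₀).toSubring := hAl n₀
  haveI hreg : IsRegularLocalRing (A n₀).toSubring := (hT1 n₀).1
  haveI : IsIntegrallyClosed (A n₀).toSubring := isIntegrallyClosed_of_isRegularLocalRing _
  letI : Algebra k (A n₀).toSubring := (A n₀).algebra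
  haveI : Algebra.EssFiniteType k (A n₀).toSubring := (hT1 n₀).2
  -- the curve chain in the fixed ring
  have hhS : ∀ i, n₀ ≤ i → h i ∈ (A n₀).toSubring := fun i hi => by
    have := hT2 i; rw [hA i hi] at this; exact this
  have hgS : ∀ i, n₀ ≤ i → g i ∈ (A n₀).toSubring := fun i hi => by
    have := (hT5 i).1; rw [hA i hi] at this; exact this
  have hxS : ∀ i, n₀ ≤ i → ∃ hwi : x i ∈ (A n₀).toSubring,
      (⟨x i, hwi⟩ : (A n₀).toSubring) ∈ maximalIdeal (A n₀).toSubring := by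
    intro i hi
    obtain ⟨hx, hxm⟩ := (hT5 i).2.2.1
    have hx' : x i ∈ (A n₀).toSubring := by have := hx; rw [hA i hi] at this; exact this
    have e : (A i).toSubring = (A n₀).toSubring := by rw [hA i hi]
    exact ⟨hx', (mem_maximalIdeal_congr e (hAl i) hloc hx hx').mp hxm⟩
  have hstep : ∀ i, n₀ ≤ i → h i - g i ^ 2 = x i ^ 2 * h (i + 1) := fun i _ => by
    rw [mul_comm]; exact (hT5 i).2.2.2.symm
  obtain ⟨c, hc, hsq⟩ :=
    CurveStepCleaning.exists_sq_eq_of_eventual_curveChain_subring k (A n₀).toSubring h g x n₀ hhS hgS hxS hstep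
  -- contradiction with the hygiene clause (T3) at `n₀`, `v = 1`
  exact hT3 n₀ c 1 hc (A n₀).one_mem one_ne_zero (by rw [div_one, hsq])

end Summit.ResolutionOfSingularities.ResolutionOfSingularities.Theorems.SwitchingDichotomy.LowTowerPointSteps
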